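import Summits.NavierStokesRegularity.NavierStokesRegularity.Theorems.TypeIIInviscidRelaxationAxisymSwirlRegularCoreReynoldsCriterion
import HarnessLib

/-!
# Two-level inflow criterion: Reynolds number `< 2` in a parabolic core, ANY bound outside

Helper toward the crux `AxisymSwirlRegular` (stmt-NavierStokesRegularity-1964, route TypeIIInviscidRelaxation),
criterion side of the registered line `radial_inflow_split` (stub `stub_oneSidedRadialCriterion`, ⟨19059⟩).
The readable corollary of `RadialInflowCoreReynolds.hasSmoothExtensionPast_of_coreReynolds` (explicit rational
Reynolds profile `D_{p,m}`):

* `exists_coreWidth_twoLevelReynolds` — for every core level `0 < d₀ < 2` and every outer level `Λ₀ > 0` there is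
  a core width `ξ₀ > 0` (explicitly `ξ₀² = max 1 (p/m)`, `p = 2 − d₀`, `m = min (p/4) (min (1/4) (p/(12Λ₀)))`)
  such that: an axisymmetric classical Leray–Hopf solution of the standing class on `[0,T)` at viscosity `ν` whose
  inflow Reynolds number `−r u_r/ν` is `≤ d₀` on the parabolic core `{r < ξ₀ √(ν(T−t))}` and `≤ Λ₀` on the rest of
  the unit tube extends smoothly past `T`.

So a blow-up of an axisymmetric solution needs EITHER an inflow Reynolds number `> d₀` (any fixed `d₀ < 2`)
somewhere inside a parabolic core of fixed width (in the similarity variable `ξ = r/√(ν(T−t))`), OR unbounded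
inflow Reynolds numbers outside it; supercritical sinks of bounded strength confined outside a parabolic core are
harmless.  The open half `C ≥ 2` of the stub is exactly the case `d₀ ≥ 2` in the core, untouched.  A CRITERION;
nothing here proves `AxisymSwirlRegular` or NavierStokesRegularity. [new]
-/

noncomputable section

set_option linter.dupNamespace false

open Set Filter Topology Real
open Literature.Analysis.FluidPDE

namespace Summit.NavierStokesRegularity.NavierStokesRegularity.Theorems.RadialInflowCoreReynolds

open Summit.NavierStokesRegularity.NavierStokesRegularity.Theorems

/-- **Two-level inflow criterion.** For every `0 < d₀ < 2` and `Λ₀ > 0` there is a core width `ξ₀ > 0` such that,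
for all `ν, T > 0` and every classical solution on `[0,T)` at viscosity `ν`, Leray–Hopf from a rapidly decaying
datum, with axisymmetric slices: if on the unit tube `0 < r ≤ 1` the radial velocity obeys `u_r ≥ −ν d₀/r` where
`r < ξ₀√(ν(T−t))` (inflow Reynolds number `≤ d₀` in the parabolic core) and `u_r ≥ −ν Λ₀/r` where
`r ≥ ξ₀√(ν(T−t))` (Reynolds number `≤ Λ₀` outside), then the solution extends smoothly past `T`.  Proof: with
`p = 2 − d₀`, `m = min (p/4) (min (1/4) (p/(12Λ₀)))`, `ξ₀ = √(max 1 (p/m))` the two-level profile lies below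
`D_{p,m}` (`coreReynolds_ge` in the core, `coreReynolds_large` outside), and `hasSmoothExtensionPast_of_coreReynolds`
applies. [new] -/
theorem exists_coreWidth_twoLevelReynolds {d₀ Λ₀ : ℝ} (hd0 : 0 < d₀) (hd2 : d₀ < 2) (hΛ : 0 < Λ₀) :
    ∃ ξ₀ : ℝ, 0 < ξ₀ ∧ ∀ (ν T : ℝ), 0 < ν → 0 < T →
      ∀ (u : ℝ → EuclideanSpace ℝ (Fin 3) → EuclideanSpace ℝ (Fin 3)) (p : ℝ → EuclideanSpace ℝ (Fin 3) → ℝ),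
      IsClassicalNSSolutionOn (Ico 0 T) ν 0 u p → IsLerayHopfOn T ν 0 (u 0) u → HasRapidSpatialDecay (u 0) →
      (∀ t ∈ Ico 0 T, IsAxisymmetric (u t)) →
      (∀ t ∈ Ico 0 T, ∀ x : EuclideanSpace ℝ (Fin 3), 0 < cylRadius x → cylRadius x ≤ 1 →
        cylRadius x < ξ₀ * √(ν * (T - t)) → -(ν * d₀ / cylRadius x) ≤ radialVelocity (u t) x) →
      (∀ t ∈ Ico 0 T, ∀ x : EuclideanSpace ℝ (Fin 3), 0 < cylRadius x → cylRadius x ≤ 1 →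
        ξ₀ * √(ν * (T - t)) ≤ cylRadius x → -(ν * Λ₀ / cylRadius x) ≤ radialVelocity (u t) x) →
      HasSmoothExtensionPast ν 0 u T := by
  -- parameters
  set q : ℝ := 2 - d₀ with hq_def
  have hq0 : 0 < q := by rw [hq_def]; linarith
  have hq2 : q < 2 := by rw [hq_def]; linarith
  set m : ℝ := min (q / 4) (min (1 / 4) (q / (12 * Λ₀))) with hm_def
  have hm0 : 0 < m := lt_min (by positivity) (lt_min (by norm_num) (by positivity))
  have hm4q : m ≤ q / 4 := min_le_left _ _
  have hm4 : m ≤ 1 / 4 := (min_le_right _ _).trans (min_le_left _ _)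
  have hmΛ : m ≤ q / (12 * Λ₀) := (min_le_right _ _).trans (min_le_right _ _)
  have hmq : m < q / 2 := by linarith
  have h2m : 2 * m ≤ 1 := by linarith
  have hΛle : Λ₀ ≤ q / (12 * m) := by
    rw [le_div_iff₀ (by positivity)]
    have := (le_div_iff₀ (by positivity : (0:ℝ) < 12 * Λ₀)).1 hmΛ
    linarith
  set ξ₀ : ℝ := √(max 1 (q / m)) with hξ₀_def
  have hmax0 : 0 < max 1 (q / m) := lt_of_lt_of_le one_pos (le_max_left _ _)
  have hξ₀ : 0 < ξ₀ := Real.sqrt_pos.2 hmax0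
  have hξ₀sq : ξ₀ ^ 2 = max 1 (q / m) := Real.sq_sqrt hmax0.le
  refine ⟨ξ₀, hξ₀, fun ν T hν hT u p hcl hLH hdec hax hcore hfar => ?_⟩
  refine hasSmoothExtensionPast_of_coreReynolds (p₀ := q) (m := m) hq0 hq2 hm0 hmq h2m hν hT hcl hLH hdec hax
    fun t ht x hx hx1 => ?_
  -- the similarity variable and the profile value
  have hs : 0 < ν * (T - t) := mul_pos hν (by linarith [ht.2])
  have hsq : 0 < √(ν * (T - t)) := Real.sqrt_pos.2 hs
  set ξ : ℝ := cylRadius x / √(ν * (T - t)) with hξ_def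
  have hξpos : 0 < ξ := div_pos hx hsq
  set D : ℝ := (q * (2 - q) + (9 / 2 * q - m - 4 * q * m) * ξ ^ 2 + (3 * m + q / 2 - 4 * m ^ 2) * ξ ^ 4)
      / ((1 + ξ ^ 2) * (q + 2 * m * ξ ^ 2)) with hD_def
  have hDge : 2 - q ≤ D := coreReynolds_ge hq0 hm0.le hmq.le ξ
  -- it suffices to bound `u_r` below by `-(ν D / r)` from the two-level gate
  show -(ν * D / cylRadius x) ≤ radialVelocity (u t) x
  by_cases hcase : cylRadius x < ξ₀ * √(ν * (T - t))
  · -- in the core: `D ≥ 2 − q = d₀`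
    have h1 := hcore t ht x hx hx1 hcase
    have h2 : ν * d₀ / cylRadius x ≤ ν * D / cylRadius x := by
      apply div_le_div_of_nonneg_right _ hx.le
      apply mul_le_mul_of_nonneg_left _ hν.le
      rw [hq_def] at hDge; linarith
    linarith
  · -- outside the core: `ξ ≥ ξ₀`, so `ξ² ≥ max 1 (q/m)` and `D ≥ q/(12m) ≥ Λ₀`
    push Not at hcase
    have h1 := hfar t ht x hx hx1 hcase
    have hξge : ξ₀ ≤ ξ := by
      rw [hξ_def, le_div_iff₀ hsq]; exact hcase
    have hξsq : ξ₀ ^ 2 ≤ ξ ^ 2 := pow_le_pow_left₀ hξ₀.le hξge 2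
    have hξ1 : 1 ≤ ξ ^ 2 := le_trans (by rw [hξ₀sq]; exact le_max_left _ _) hξsq
    have hξq : q / m ≤ ξ ^ 2 := le_trans (by rw [hξ₀sq]; exact le_max_right _ _) hξsq
    have hDlarge : q / (12 * m) ≤ D := coreReynolds_large hq0 hm0 hm4 hmq hξ1 hξq
    have h2 : ν * Λ₀ / cylRadius x ≤ ν * D / cylRadius x := by
      apply div_le_div_of_nonneg_right _ hx.le
      apply mul_le_mul_of_nonneg_left _ hν.le
      linarith
    linarith

end Summit.NavierStokesRegularity.NavierStokesRegularity.Theorems.RadialInflowCoreReynolds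

end
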